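import Summits.QuantumFields.BalabanUV.T4Continuum.Spine.NE1p.DressedTransportScheduled
import Summits.QuantumFields.BalabanUV.T4Continuum.Spine.NE1p.DressedUniformConstants

/-!
# T⁴ programme, spine estimate NE1′ (node O3b/H2) — END-F‴: (w4) DISCHARGED BY THE CHART-RADIUS FLOOR, AND THE CREW'S
# PER-CUTOFF LEAF BUNDLE OVER THE UNIFORM CONSTANTS (swarm row S3b = S1b ∘ S3 of `t4/formal/NE1p/LEAVES.md` v2)

Cell `pub-balaban`, sub-cell `t4`, BINDER-OWNERS row NE1′, formalisation swarm `b2b-balaban-t4-ne1p-formalise-*`, seat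
`b2b-balaban-t4-ne1p-formalise-leaf-09` (holder of row S3 `Spine/NE1p/DressedUniformConstants.lean`, p212599; INTENT NE1p-S3b in
HOME/CLAIMS.log); owner lineage t4-ne1p-p1 (skeleton `t4/skeletons/NE1p-t4-ne1p-p1.md` v1.1 §2 ∕ §6).  ADDITIVE — imports
`Spine/NE1p/DressedTransportScheduled` (row S1b, leaf-04: END-F″ `transportLeaf_assembled_of_schedule`, p212785) and
`Spine/NE1p/DressedUniformConstants` (row S3: `alphaCell`, `hdom_cell`, `uniformConstantsCell`, `bookingLeavesCell`) ONLY.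

WHAT THIS FILE DOES.  END-F″ displays, besides the wall, ONE arithmetic binder: (w4) `hdom : e³·(1 + 4·(2σ k)∕ϱc k) ≤ α k` for a
step-factor profile `α` with `0 ≤ α i`.  Its own window schedule bounds the fluctuation diameter by the chart window (`2σ k ≤ w`)
and its own floor keeps the chart radius above `r_*` (`r_* ≤ ϱc k`), so the diameter∕radius ratio is K-FREE: `2σ k ≤ (w∕r_*)·ϱc k`
(§1 `two_sigma_le_ratio_of_floor`).  Hence (w4) HOLDS with the CONSTANT profile `α := fun _ => alphaCell (w∕r_*) = e³·(1 + 4w∕r_*)`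
(§1 `hdom_of_floor`, row S3's `hdom_cell`) — no separate binder is left for (w4): it is paid by the floored schedule ((w3)⁺'s data).
§2 **END-F‴ `transportLeaf_uniform_of_schedule`** = END-F″ with `hα`∕`hdom` DISCHARGED; conclusion VERBATIM the field type of
`BookingLeaves.htr` at `C = 4c_δ∕r`, `ρ i = ψ·alphaCell (w∕r_*)`.  §3 **`bookingLeaves_uniform_of_schedule`**: at the cell's transverse
rate `ψ := L⁻²` (F-6's READING, caveat k3 — a parameter choice, not asserted) the per-cutoff bundle
`BookingLeaves (uniformConstantsCell L (4c_δ∕r) c̄ (w∕r_*) N₀ A₀ m s̄⁰ ρ′ …) B T` with `htr` discharged by §2 and `hρ`∕`hc`∕`hrate`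
by row S3; displayed per cutoff = the wall binders of END-F″ ((w1) `hsl`, H2 dictionary, (w2-act) `hB`∕`hE`, `hDμ`∕`hz₁`, (I4′),
`hcm`, attainment, invariance, measurability, the floor), (w5) `hreg` with `0 ≤ c k ≤ c̄`, (w2-act) `hs₀`, (w3-book) `hS`∕`hcount`
(row S4's `DressedPositionalCount` instance supplies them at instantiation), (w1)+(w5b) `hbirth` (row S5's suppliers), and the two
located scalars of row S3: `locCell L (4c_δ∕r) c̄ (w∕r_*) = e³(1+4w∕r_*)∕L + L·(4c_δ∕r)·c̄ ≤ ρ′ < 1` ((w7)) and the window (w6).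
§1 also gives the floor-free form `hdom_of_ratioBound` (any K-free ratio bound `2σ k ≤ κ·ϱc k` on the schedule ⇒ `hdom` with
`α := fun _ => alphaCell κ`) that the ratio-END S2c's consumers use.  §4: the floor-free witness `RatioGeometric.schedule r w ρ₀`
(`σ k := min (w∕2) (ϱc k)`, κ = 2, radii shrinking geometrically — XREAD NE1p-X3 INFO-2 in the tree) and, on leaf-04's floored
witness `Floored.schedule r w ρ₀` (floor `r∕4`), the ratio `κ = 4w∕r` (`hdom_floored`).

LOCATED COST = CAVEAT LF-1 (leaf-08 F-ne1pleaf08-1, typer ruling R-T8, OWNER-ANSWERS-g23 §F∕§G; recorded, not resolved): the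
uniform floor `r_*` and the chart window `w` are each consumed once per met step (`WindowSchedule.window_budget`: `ρw K + K·w ≤ ρw 0`),
so §2∕§3 instantiate only with a birth window growing with the number of met steps of a family (or a cap on them) — (w3)⁺'s
content; the K-free face is S2c (ratio-END, no floor) under a ratio-bounded schedule, served by §1's `hdom_of_ratioBound`.

HONEST FRAMING.  Kernel composition over hypothesis shapes ([folklore]; 0 sorry; 0 citations used as facts; no `def … : Prop`).
Headline: «(w4) ⇐ the floored window schedule; L-T ⇐ F-1…F-9 minus F-4∕F-5∕F-7; NE1′ ⇐ the named wall binders», NEVER «NE1′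
proved»; 0 leaves instantiated on Bałaban's densities; the wall (w1), (w2-act) THE NUMBER, (w3)⁺, (w5), (w6), (w7)'s located
largeness, F-6's rate stands; spine PROVED 0∕9.  Rung (B)+1 on ONE finite four-torus — NOT infinite volume, NOT a mass gap, NOT
OS on ℝ⁴, NOT Clay.  HONEST DEPENDENCY: continuum YM on T⁴ ⇐ BetaPertH ∧ nine spine estimates (0/9 proved); BetaPertH ⇐ (D1) ∧
(D4) ∧ CAP+tail; G-an2-4 gates asym, D1 and NE2/3/4.
-/

noncomputable section

namespace Summit.QuantumFields.BalabanUV.T4Continuum.NE1p.DressedTransportUniform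

open MeasureTheory Set Metric Finset
open scoped BigOperators
open Literature.MathematicalPhysics.QuantumFieldTheory.Balaban1983to89
open Literature.MathematicalPhysics.QuantumFieldTheory.Balaban1983to89.T4TermFormat
open Literature.MathematicalPhysics.QuantumFieldTheory.Balaban1983to89.T4GatedBooking
open Literature.MathematicalPhysics.QuantumFieldTheory.Balaban1983to89.T4TrajectoryComparison
open Literature.MathematicalPhysics.QuantumFieldTheory.Balaban1983to89.T4TrajectoryModulus
open T4BirthChartTransport (GaugeInvariant BirthSlice RelGauge)
open T4BlockTransport (Fld NDir latMove latN)
open T4TrajectoryDensity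
open Summit.QuantumFields.BalabanUV.T4Continuum.T4TrajectoryDensityDressed
open Summit.QuantumFields.BalabanUV.T4Continuum.NE1p.DressedRoot
open Summit.QuantumFields.BalabanUV.T4Continuum.NE1p.DressedWindowSchedule
open Summit.QuantumFields.BalabanUV.T4Continuum.NE1p.DressedTransportScheduled
open Summit.QuantumFields.BalabanUV.T4Continuum.NE1p.DressedUniformConstants

/-! ## §1 The K-free diameter∕radius ratio from the floor, and (w4) discharged -/

section Ratio

variable {r w : ℝ} (W : WindowSchedule r w)

/-- **THE RATIO FROM THE FLOOR** [arith]: the schedule's `2σ k ≤ w` and the floor `r_* ≤ ϱc k` (`r_* > 0`) give the K-free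
diameter∕radius bound `2σ k ≤ (w∕r_*)·ϱc k` at every step. [folklore] -/
theorem two_sigma_le_ratio_of_floor {rstar : ℝ} (hrstar : 0 < rstar) (hfloor : ∀ k, rstar ≤ W.ϱc k) (k : ℕ) :
    2 * W.σ k ≤ w / rstar * W.ϱc k := by
  have hw : 0 ≤ w := le_of_lt W.w_pos
  calc 2 * W.σ k ≤ w := W.hσw k
    _ = w / rstar * rstar := by rw [div_mul_cancel₀ w hrstar.ne']
    _ ≤ w / rstar * W.ϱc k := mul_le_mul_of_nonneg_left (hfloor k) (div_nonneg hw hrstar.le)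

/-- The ratio `w∕r_*` is nonnegative. [folklore] -/
theorem ratio_nonneg (W : WindowSchedule r w) {rstar : ℝ} (hrstar : 0 < rstar) : 0 ≤ w / rstar :=
  div_nonneg (le_of_lt W.w_pos) hrstar.le

/-- **(w4) FROM A K-FREE RATIO BOUND ON THE SCHEDULE** [arith]: if the fluctuation diameter is at most `κ` times the chart
radius at every step (`2σ k ≤ κ·ϱc k` — a displayed, K-free property of the schedule; NO floor needed, radii may shrink as the
schedule likes, cf. §4's `ratioGeometric`), then the per-step binder `hdom` of `transportLeaf_of_schedule` ∕ END-F″ (and of any END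
face indexed the same way, e.g. the ratio-END S2c under a schedule) holds VERBATIM with the CONSTANT profile
`α := fun _ => alphaCell κ`. [folklore] -/
theorem hdom_of_ratioBound {B : T4TermFormat.Booking} {κ : ℝ} (hratio : ∀ k, 2 * W.σ k ≤ κ * W.ϱc k) :
    ∀ k, k + 1 ≤ B.K → Real.exp 3 * (1 + 4 * (2 * W.σ k) / W.ϱc k) ≤ (fun _ : ℕ => alphaCell κ) k :=
  fun k _ => hdom_cell (W.hϱc k) (hratio k)

/-- A ratio bound forces `κ ≥ 0` (diameters are positive), so the constant profile is nonnegative (`hα`). [folklore] -/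
theorem hα_of_ratioBound {κ : ℝ} (hratio : ∀ k, 2 * W.σ k ≤ κ * W.ϱc k) : ∀ i : ℕ, 0 ≤ (fun _ : ℕ => alphaCell κ) i := by
  have hκ : 0 ≤ κ := le_of_not_gt fun h =>
    (not_le.mpr ((mul_neg_of_neg_of_pos h (W.hϱc 0)).trans (by linarith [W.hσ 0]))) (hratio 0)
  exact fun _ => alphaCell_nonneg hκ

/-- **(w4) DISCHARGED BY THE FLOOR** [arith]: END-F″'s (and `transportLeaf_of_schedule`'s) per-step binder `hdom` VERBATIM with the
CONSTANT K-free profile `α := fun _ => alphaCell (w∕r_*)` — the special case `κ := w∕r_*` of `hdom_of_ratioBound`. [folklore] -/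
theorem hdom_of_floor {B : T4TermFormat.Booking} {rstar : ℝ} (hrstar : 0 < rstar) (hfloor : ∀ k, rstar ≤ W.ϱc k) :
    ∀ k, k + 1 ≤ B.K → Real.exp 3 * (1 + 4 * (2 * W.σ k) / W.ϱc k) ≤ (fun _ : ℕ => alphaCell (w / rstar)) k :=
  hdom_of_ratioBound W (two_sigma_le_ratio_of_floor W hrstar hfloor)

/-- The constant profile is nonnegative (END-F″'s `hα`). [folklore] -/
theorem hα_of_floor (W : WindowSchedule r w) {rstar : ℝ} (hrstar : 0 < rstar) :
    ∀ i : ℕ, 0 ≤ (fun _ : ℕ => alphaCell (w / rstar)) i :=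
  fun _ => alphaCell_nonneg (ratio_nonneg W hrstar)

end Ratio

/-! ## §2 END-F‴: END-F″ with `hα` and `hdom` discharged, the rate profile constant -/

section FunctionLevel

variable {r w : ℝ} (W : WindowSchedule r w)
variable {B : T4TermFormat.Booking} {T : Trajectory B}
variable {R : Type*} [NormedRing R] [NormedAlgebra ℂ R] [MeasurableSpace R] {d : ℕ}

/-- **END-F‴ — THE TRANSPORT LEAF `htr` WITH NO WINDOW GEOMETRY, NO BUDGET BINDER AND NO (w4) BINDER** [bookkeeping]: leaf-04's
END-F″ `DressedTransportScheduled.transportLeaf_assembled_of_schedule` with the step-factor profile FIXED to the K-free constant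
`α := fun _ => alphaCell (w∕r_*)` — its binders `hα` and (w4) `hdom` are DISCHARGED by §1 from the schedule and the floor.  Displayed
(wall ∕ dictionary only): (w1) `hsl`; H2 `hFn`∕`h𝒢` and the fresh-sum dictionary `hQ`∕`hSg`∕`hs1`∕`hAsz_birth`∕`hAsz_step`∕`hcm`;
(w2-act) `hB`∕`hE` (printed TYPE [Balaban1989LargeFieldII] (1.65) p. 375, (1.71)–(1.75) pp. 379–380 — asserted for Bałaban's
densities NOWHERE); `hDμ`∕`hz₁`; (I4′) `hpairx`∕`hδf`∕`hδfw`∕`hdefw`∕`hrate`; scalars `hcδ`∕`hψ`∕`hrstar`∕`hfloor`; attainment `hlin`;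
invariance; measurability.  Conclusion: VERBATIM the field type of `BookingLeaves.htr` with `C = 4c_δ∕r`, `ρ i = ψ·alphaCell (w∕r_*)`.
CAVEAT LF-1 (leaf-08 F-ne1pleaf08-1, typer ruling R-T8), carried verbatim: with a UNIFORM floor `r_*` the schedule's gap consumes
`≥ w + r_*` of window radius per met step, so this face instantiates only with a birth window `ρw 0` (hence F-1's `hsl` window)
growing linearly in the number of met steps of a family — the K-free face is the ratio-END S2c under a ratio-bounded schedule
(§1 `hdom_of_ratioBound`, §4 `ratioGeometric`); the constants `U` of §3 themselves stay K-∕μ-free. [folklore] -/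
theorem transportLeaf_uniform_of_schedule {Fn : B.Birth → ℕ → ℕ → Fld d R → ℂ}
    {rel : B.Birth → ℕ → ℕ → Fld d R → Fld d R → Prop}
    {ref : B.Birth → ℕ → Fld d R → Fld d R} {base : B.Birth → ℕ → Fld d R → ℝ}
    {𝒜 𝒬 : B.Birth → ℕ → Fld d R → Fld d R → ℂ} {q : B.Birth → ℕ → Fld d R → ℂ}
    {μ : B.Birth → ℕ → Measure (Fld d R)} {z₀ z₁ : B.Birth → ℕ → Fld d R}
    {defect : B.Birth → ℕ → ℕ → ℝ} {cδ ψ rstar m : ℝ} {s s1 : B.Birth → ℕ → ℝ}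
    {Asz : B.Birth → ℕ → ℕ → ℝ} {S : ℕ → B.Birth → Finset B.Birth}
    {Sg : ℕ → B.Birth → Finset (B.Birth × ℕ)} {c : B.Birth → ℕ → ℂ} {δf : B.Birth → ℕ → B.Birth × ℕ → ℝ}
    (hr : 0 < r) (hcδ : 0 ≤ cδ) (hψ : 0 ≤ ψ) (hrstar : 0 < rstar) (hfloor : ∀ k, rstar ≤ W.ϱc k)
    (hsl : ∀ (b : B.Birth) (k' : ℕ), B.birthScale b ≤ k' → k' ≤ B.K →
      RanBelow (budgetGate T s m S (4 * cδ / r) (fun i => ψ * (fun _ : ℕ => alphaCell (w / rstar)) i)) k' →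
      BirthSlice (Fn b k' k') latMove latN (bondBall d (W.ρw k') : Set (Fld d R)) w r (T.gen b k'))
    (hFn : ∀ (b : B.Birth) (k' k : ℕ), B.birthScale b ≤ k' → k' ≤ k → k + 1 ≤ B.K →
      RanBelow (budgetGate T s m S (4 * cδ / r) (fun i => ψ * (fun _ : ℕ => alphaCell (w / rstar)) i)) (k + 1) →
      ∀ U, Fn b k' (k + 1) U =
        wOp (expWeight (base b k) (𝒜 b k + 𝒬 b k)) (μ b k) (z₀ b k) U (fun z => Fn b k' k (U + z)))
    (h𝒢 : ∀ (b : B.Birth) (k' k : ℕ), B.birthScale b ≤ k' → k' ≤ k → k + 1 ≤ B.K →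
      RanBelow (budgetGate T s m S (4 * cδ / r) (fun i => ψ * (fun _ : ℕ => alphaCell (w / rstar)) i)) (k + 1) →
      ∀ U, (fun z => Fn b k' k (U + z)) ∈ BddClass ℂ (μ b k))
    (hB : ∀ (b : B.Birth) (k' k : ℕ), B.birthScale b ≤ k' → k' ≤ k → k + 1 ≤ B.K →
      RanBelow (budgetGate T s m S (4 * cδ / r) (fun i => ψ * (fun _ : ℕ => alphaCell (w / rstar)) i)) (k + 1) →
      RealBaseAt (ref b k) (base b k) (𝒜 b k) (μ b k) (bondBall d (W.ρw (k + 1)) : Set (Fld d R)))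
    (hE : ∀ (b : B.Birth) (k' k : ℕ), B.birthScale b ≤ k' → k' ≤ k → k + 1 ≤ B.K →
      RanBelow (budgetGate T s m S (4 * cδ / r) (fun i => ψ * (fun _ : ℕ => alphaCell (w / rstar)) i)) (k + 1) →
      ExponentSliceAt (ref b k) (𝒜 b k) (μ b k) latMove latN (bondBall d (W.ρw (k + 1)) : Set (Fld d R)) w (W.ϱc k)
        (s b k))
    (hQ : ∀ b k, (fun U z => 𝒬 b k U z - q b k U) =
      fun U z => c b k * ∑ p ∈ Sg k b, (Fn p.1 p.2 k (U + z) - Fn p.1 p.2 k (U + z₁ b k)))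
    (hSg : ∀ k b, ∀ p ∈ Sg k b, p.1 ∈ S k b ∧ B.birthScale p.1 ≤ p.2 ∧ p.2 ≤ k)
    (hs1 : ∀ b k, s1 b k = ‖c b k‖ * ∑ p ∈ Sg k b, 4 * Asz p.1 p.2 k / W.sliceR p.2 k * δf b k p)
    (hAsz_birth : ∀ f k'', Asz f k'' k'' = T.gen f k'')
    (hAsz_step : ∀ f k'' k, B.birthScale f ≤ k'' → k'' ≤ k →
      Asz f k'' (k + 1) = Real.exp (3 * (s f k + s1 f k)) * Asz f k'' k)
    (hcm : ∀ b k, ‖c b k‖ * r ≤ m * rstar)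
    (hδf : ∀ b k, ∀ p ∈ Sg k b, 0 ≤ δf b k p ∧ δf b k p ≤ cδ * ψ ^ (k - p.2))
    (hδfw : ∀ b k, ∀ p ∈ Sg k b, δf b k p ≤ w)
    (hDμ : ∀ b k, ∀ᵐ z ∂μ b k, z ∈ (bondBall d (W.σ k) : Set (Fld d R)))
    (hz₁ : ∀ b k, z₁ b k ∈ (bondBall d (W.σ k) : Set (Fld d R)))
    (hpairx : ∀ (b : B.Birth) (k' k : ℕ), B.birthScale b ≤ k' → k' ≤ k →
      ∀ p ∈ Sg k b, ∀ U₀ ∈ (bondBall d (W.ρw (k + 1)) : Set (Fld d R)), ∀ pd : NDir d R, 0 < latN pd → latN pd ≤ w →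
        ∀ᵐ z ∂μ b k, ∀ t ∈ tube (W.ϱ₁ k / latN pd),
          RelGauge (rel p.1 p.2 k) latMove latN (latMove U₀ pd t + z₁ b k) (latMove U₀ pd t + z) (δf b k p))
    (hinv : ∀ b k' k, GaugeInvariant (rel b k' k) (Fn b k' k))
    (hmeas : ∀ (b f : B.Birth) (k'' k : ℕ) (U : Fld d R), AEStronglyMeasurable (fun z => Fn f k'' k (U + z)) (μ b k))
    (hdefw : ∀ b k' k, defect b k' k ≤ w)
    (hrate : ∀ (b : B.Birth) (k' k : ℕ), B.birthScale b ≤ k' → k' ≤ k → k ≤ B.K →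
      defect b k' k ≤ cδ * ψ ^ (k - k'))
    (hlin : ∀ (b : B.Birth) (k' k : ℕ), B.birthScale b ≤ k' → k' ≤ k → k ≤ B.K →
      RanBelow (budgetGate T s m S (4 * cδ / r) (fun i => ψ * (fun _ : ℕ => alphaCell (w / rstar)) i)) k → ∀ ε > 0,
      ∃ U₀ ∈ (bondBall d (W.ρw k) : Set (Fld d R)), ∃ U₁ : Fld d R,
        RelGauge (rel b k' k) latMove latN U₀ U₁ (defect b k' k) ∧
        T.lin b k' k ≤ ‖Fn b k' k U₁ - Fn b k' k U₀‖ + ε) :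
    T.TransportsFromVar (4 * cδ / r) (fun i => ψ * (fun _ : ℕ => alphaCell (w / rstar)) i)
      (budgetGate T s m S (4 * cδ / r) (fun i => ψ * (fun _ : ℕ => alphaCell (w / rstar)) i)) :=
  transportLeaf_assembled_of_schedule W (hα_of_floor W hrstar) hr hcδ hψ hrstar hfloor hsl hFn h𝒢 hB hE hQ hSg hs1 hAsz_birth
    hAsz_step hcm hδf hδfw hDμ hz₁ hpairx (hdom_of_floor W hrstar hfloor) hinv hmeas hdefw hrate hlin

end FunctionLevel

/-! ## §3 The per-cutoff leaf bundle over the uniform constants, `htr` discharged by END-F‴ -/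

section Bundle

variable {r w : ℝ} (W : WindowSchedule r w)
variable {B : T4TermFormat.Booking} {T : Trajectory B}
variable {R : Type*} [NormedRing R] [NormedAlgebra ℂ R] [MeasurableSpace R] {d : ℕ}

/-- **THE CREW'S PER-CUTOFF BUNDLE** [bookkeeping]: at the cell's transverse rate `ψ := L⁻²` (F-6's reading — a parameter choice)
and the K-∕μ-free constants `U := uniformConstantsCell L (4c_δ∕r) c̄ (w∕r_*) N₀ A₀ m s̄⁰ ρ′` of row S3, the leaf binders
`BookingLeaves U B T` of END-B with: T `htr` DISCHARGED by END-F‴ (§2; so F-4, F-5, F-7, F-9 and the window geometry are gone),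
(w7) `hrate`∕`hρ`∕`hc` DISCHARGED by row S3.  DISPLAYED, per cutoff: the wall ∕ dictionary binders of END-F‴; (w5) `hreg` with
`0 ≤ creg k ≤ c̄`; (w2-act) `hs₀ : s b k ≤ s̄⁰`; (w3-book) `hS`∕`hcount` at rate `L⁴` (row S4's instance); (w1)+(w5b) `hbirth` in
the class `twoRate A₀ (rhoOne L⁻² (4c_δ∕r) c̄ (w∕r_*)) L⁻³ K` (row S5's suppliers); and row S3's located scalars `1 ≤ L`,
`locCell L (4c_δ∕r) c̄ (w∕r_*) ≤ ρ′ < 1` ((w7)), `m·(N₀A₀(1−ρ′)⁻¹) ≤ 1 − s̄⁰` ((w6)).  Nothing of Bałaban's densities asserted.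
[folklore] -/
def bookingLeaves_uniform_of_schedule {L cbar N₀ A₀ sbar ρ' : ℝ} {Fn : B.Birth → ℕ → ℕ → Fld d R → ℂ}
    {rel : B.Birth → ℕ → ℕ → Fld d R → Fld d R → Prop}
    {ref : B.Birth → ℕ → Fld d R → Fld d R} {base : B.Birth → ℕ → Fld d R → ℝ}
    {𝒜 𝒬 : B.Birth → ℕ → Fld d R → Fld d R → ℂ} {q : B.Birth → ℕ → Fld d R → ℂ}
    {μ : B.Birth → ℕ → Measure (Fld d R)} {z₀ z₁ : B.Birth → ℕ → Fld d R}
    {defect : B.Birth → ℕ → ℕ → ℝ} {cδ rstar m : ℝ} {s s1 : B.Birth → ℕ → ℝ}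
    {Asz : B.Birth → ℕ → ℕ → ℝ} {S : ℕ → B.Birth → Finset B.Birth}
    {Sg : ℕ → B.Birth → Finset (B.Birth × ℕ)} {c : B.Birth → ℕ → ℂ} {δf : B.Birth → ℕ → B.Birth × ℕ → ℝ}
    {creg : ℕ → ℝ}
    -- row S3's located scalars ((w7) largeness, (w6) window) and signs
    (hL : 1 ≤ L) (hcbar : 0 ≤ cbar) (hN₀ : 0 ≤ N₀) (hA₀ : 0 ≤ A₀) (hm : 0 ≤ m)
    (hloc : locCell L (4 * cδ / r) cbar (w / rstar) ≤ ρ') (hρ'1 : ρ' < 1)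
    (hsmall : m * (N₀ * A₀ * (1 - ρ')⁻¹) ≤ 1 - sbar)
    -- END-F‴'s scalars and floor
    (hr : 0 < r) (hcδ : 0 ≤ cδ) (hrstar : 0 < rstar) (hfloor : ∀ k, rstar ≤ W.ϱc k)
    -- END-F‴'s wall ∕ dictionary binders at ψ := L⁻²
    (hsl : ∀ (b : B.Birth) (k' : ℕ), B.birthScale b ≤ k' → k' ≤ B.K →
      RanBelow (budgetGate T s m S (4 * cδ / r) (fun i => (L ^ 2)⁻¹ * (fun _ : ℕ => alphaCell (w / rstar)) i)) k' →
      BirthSlice (Fn b k' k') latMove latN (bondBall d (W.ρw k') : Set (Fld d R)) w r (T.gen b k'))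
    (hFn : ∀ (b : B.Birth) (k' k : ℕ), B.birthScale b ≤ k' → k' ≤ k → k + 1 ≤ B.K →
      RanBelow (budgetGate T s m S (4 * cδ / r) (fun i => (L ^ 2)⁻¹ * (fun _ : ℕ => alphaCell (w / rstar)) i)) (k + 1) →
      ∀ U, Fn b k' (k + 1) U =
        wOp (expWeight (base b k) (𝒜 b k + 𝒬 b k)) (μ b k) (z₀ b k) U (fun z => Fn b k' k (U + z)))
    (h𝒢 : ∀ (b : B.Birth) (k' k : ℕ), B.birthScale b ≤ k' → k' ≤ k → k + 1 ≤ B.K →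
      RanBelow (budgetGate T s m S (4 * cδ / r) (fun i => (L ^ 2)⁻¹ * (fun _ : ℕ => alphaCell (w / rstar)) i)) (k + 1) →
      ∀ U, (fun z => Fn b k' k (U + z)) ∈ BddClass ℂ (μ b k))
    (hB : ∀ (b : B.Birth) (k' k : ℕ), B.birthScale b ≤ k' → k' ≤ k → k + 1 ≤ B.K →
      RanBelow (budgetGate T s m S (4 * cδ / r) (fun i => (L ^ 2)⁻¹ * (fun _ : ℕ => alphaCell (w / rstar)) i)) (k + 1) →
      RealBaseAt (ref b k) (base b k) (𝒜 b k) (μ b k) (bondBall d (W.ρw (k + 1)) : Set (Fld d R)))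
    (hE : ∀ (b : B.Birth) (k' k : ℕ), B.birthScale b ≤ k' → k' ≤ k → k + 1 ≤ B.K →
      RanBelow (budgetGate T s m S (4 * cδ / r) (fun i => (L ^ 2)⁻¹ * (fun _ : ℕ => alphaCell (w / rstar)) i)) (k + 1) →
      ExponentSliceAt (ref b k) (𝒜 b k) (μ b k) latMove latN (bondBall d (W.ρw (k + 1)) : Set (Fld d R)) w (W.ϱc k)
        (s b k))
    (hQ : ∀ b k, (fun U z => 𝒬 b k U z - q b k U) =
      fun U z => c b k * ∑ p ∈ Sg k b, (Fn p.1 p.2 k (U + z) - Fn p.1 p.2 k (U + z₁ b k)))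
    (hSg : ∀ k b, ∀ p ∈ Sg k b, p.1 ∈ S k b ∧ B.birthScale p.1 ≤ p.2 ∧ p.2 ≤ k)
    (hs1 : ∀ b k, s1 b k = ‖c b k‖ * ∑ p ∈ Sg k b, 4 * Asz p.1 p.2 k / W.sliceR p.2 k * δf b k p)
    (hAsz_birth : ∀ f k'', Asz f k'' k'' = T.gen f k'')
    (hAsz_step : ∀ f k'' k, B.birthScale f ≤ k'' → k'' ≤ k →
      Asz f k'' (k + 1) = Real.exp (3 * (s f k + s1 f k)) * Asz f k'' k)
    (hcm : ∀ b k, ‖c b k‖ * r ≤ m * rstar)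
    (hδf : ∀ b k, ∀ p ∈ Sg k b, 0 ≤ δf b k p ∧ δf b k p ≤ cδ * ((L ^ 2)⁻¹) ^ (k - p.2))
    (hδfw : ∀ b k, ∀ p ∈ Sg k b, δf b k p ≤ w)
    (hDμ : ∀ b k, ∀ᵐ z ∂μ b k, z ∈ (bondBall d (W.σ k) : Set (Fld d R)))
    (hz₁ : ∀ b k, z₁ b k ∈ (bondBall d (W.σ k) : Set (Fld d R)))
    (hpairx : ∀ (b : B.Birth) (k' k : ℕ), B.birthScale b ≤ k' → k' ≤ k →
      ∀ p ∈ Sg k b, ∀ U₀ ∈ (bondBall d (W.ρw (k + 1)) : Set (Fld d R)), ∀ pd : NDir d R, 0 < latN pd → latN pd ≤ w →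
        ∀ᵐ z ∂μ b k, ∀ t ∈ tube (W.ϱ₁ k / latN pd),
          RelGauge (rel p.1 p.2 k) latMove latN (latMove U₀ pd t + z₁ b k) (latMove U₀ pd t + z) (δf b k p))
    (hinv : ∀ b k' k, GaugeInvariant (rel b k' k) (Fn b k' k))
    (hmeas : ∀ (b f : B.Birth) (k'' k : ℕ) (U : Fld d R), AEStronglyMeasurable (fun z => Fn f k'' k (U + z)) (μ b k))
    (hdefw : ∀ b k' k, defect b k' k ≤ w)
    (hrate : ∀ (b : B.Birth) (k' k : ℕ), B.birthScale b ≤ k' → k' ≤ k → k ≤ B.K →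
      defect b k' k ≤ cδ * ((L ^ 2)⁻¹) ^ (k - k'))
    (hlin : ∀ (b : B.Birth) (k' k : ℕ), B.birthScale b ≤ k' → k' ≤ k → k ≤ B.K →
      RanBelow (budgetGate T s m S (4 * cδ / r) (fun i => (L ^ 2)⁻¹ * (fun _ : ℕ => alphaCell (w / rstar)) i)) k →
      ∀ ε > 0, ∃ U₀ ∈ (bondBall d (W.ρw k) : Set (Fld d R)), ∃ U₁ : Fld d R,
        RelGauge (rel b k' k) latMove latN U₀ U₁ (defect b k' k) ∧
        T.lin b k' k ≤ ‖Fn b k' k U₁ - Fn b k' k U₀‖ + ε)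
    -- the booking-level wall binders: (w5) regeneration, (w2-act) margin, (w3-book) counts, (w1)+(w5b) births
    (hc0 : ∀ k, 0 ≤ creg k) (hcb : ∀ k, k < B.K → creg k ≤ cbar)
    (hreg : T.RegeneratesFromVar creg
      (budgetGate T s m S (4 * cδ / r) (fun _ : ℕ => (L ^ 2)⁻¹ * alphaCell (w / rstar))))
    (hs₀ : ∀ b k, s b k ≤ sbar)
    (hS : ∀ k b, ∀ f ∈ S k b, B.birthScale f ≤ k)
    (hcount : ∀ k b, ∀ j ≤ k, (((S k b).filter fun f => B.birthScale f = j).card : ℝ) ≤ N₀ * (L ^ 4) ^ (k - j))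
    (hbirth : T.BirthsFromOld (4 * cδ / r) (fun _ : ℕ => (L ^ 2)⁻¹ * alphaCell (w / rstar))
      (twoRate A₀ (rhoOne (L ^ 2)⁻¹ (4 * cδ / r) cbar (w / rstar)) (L⁻¹ ^ 3) B.K)
      (budgetGate T s m S (4 * cδ / r) (fun _ : ℕ => (L ^ 2)⁻¹ * alphaCell (w / rstar)))) :
    BookingLeaves (uniformConstantsCell L (4 * cδ / r) cbar (w / rstar) N₀ A₀ m sbar ρ' hL
      (div_nonneg (mul_nonneg (by norm_num) hcδ) hr.le) hcbar (ratio_nonneg W hrstar) hN₀ hA₀ hm hloc hρ'1 hsmall) B T :=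
  bookingLeavesCell hL (div_nonneg (mul_nonneg (by norm_num) hcδ) hr.le) hcbar (ratio_nonneg W hrstar) hN₀ hA₀ hm hloc hρ'1
    hsmall creg s S hc0 hcb hS hcount hs₀ hbirth
    (transportLeaf_uniform_of_schedule W hr hcδ (inv_nonneg.mpr (sq_nonneg L)) hrstar hfloor hsl hFn h𝒢 hB hE hQ hSg hs1
      hAsz_birth hAsz_step hcm hδf hδfw hDμ hz₁ hpairx hinv hmeas hdefw hrate hlin)
    hreg

end Bundle

/-! ## §4 Witnesses: a ratio-bounded schedule WITHOUT a floor, and the ratio on leaf-04's floored schedule -/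

namespace RatioGeometric

/-- **A RATIO-BOUNDED WINDOW SCHEDULE WITH NO FLOOR** [decided toy] (the tree home of XREAD NE1p-X3 INFO-2): for every `r, w > 0`
and birth window `ρ₀` — chart radii `r·2^{−(k+2)}`, margins `r·2^{−(k+1)}` (as in `WindowSchedule.geometric`), windows
`ρw k = ρ₀ − (2w + r)·k`, but the fluctuation radius FOLLOWS the chart radius: `σ k := min (w∕2) (ϱc k)`.  Radii shrink
geometrically (no floor, so no `r_*` is consumed), yet the diameter∕radius ratio is K-free: `2σ k ≤ 2·ϱc k` (`ratio_le`). [folklore] -/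
def schedule (r w ρ₀ : ℝ) (hr : 0 < r) (hw : 0 < w) : WindowSchedule r w where
  ρw k := ρ₀ - (2 * w + r) * k
  σ k := min (w / 2) (r / 2 ^ (k + 1) / 2)
  ϱc k := r / 2 ^ (k + 1) / 2
  ϱ₁ k := r / 2 ^ (k + 1)
  hσ _ := lt_min (by positivity) (by positivity)
  hσw k := by have := min_le_left (w / 2) (r / 2 ^ (k + 1) / 2); linarith
  hϱc _ := by positivity
  hϱc₁ k := half_lt_self (by positivity)
  hϱ₁r k := div_le_self hr.le (one_le_pow₀ (by norm_num))
  hϱ₁c k := le_of_eq (by rw [pow_succ]; ring)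
  hgap k := by
    have h : r / 2 ^ (k + 1) ≤ r := div_le_self hr.le (one_le_pow₀ (by norm_num))
    have hmin := min_le_left (w / 2) (r / 2 ^ (k + 1) / 2)
    push_cast
    nlinarith

/-- [decided toy] The K-free ratio: `2σ k ≤ 2·ϱc k` at every step. [folklore] -/
theorem ratio_le (r w ρ₀ : ℝ) (hr : 0 < r) (hw : 0 < w) (k : ℕ) :
    2 * (schedule r w ρ₀ hr hw).σ k ≤ 2 * (schedule r w ρ₀ hr hw).ϱc k := by
  show 2 * min (w / 2) (r / 2 ^ (k + 1) / 2) ≤ 2 * (r / 2 ^ (k + 1) / 2)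
  have := min_le_right (w / 2) (r / 2 ^ (k + 1) / 2)
  linarith

/-- [decided toy] Hence (w4) along it with the K-free profile `α := fun _ => alphaCell 2 = e³·9`. [folklore] -/
theorem hdom (B : T4TermFormat.Booking) (r w ρ₀ : ℝ) (hr : 0 < r) (hw : 0 < w) :
    ∀ k, k + 1 ≤ B.K →
      Real.exp 3 * (1 + 4 * (2 * (schedule r w ρ₀ hr hw).σ k) / (schedule r w ρ₀ hr hw).ϱc k) ≤
        (fun _ : ℕ => alphaCell 2) k :=
  hdom_of_ratioBound (schedule r w ρ₀ hr hw) (B := B) (ratio_le r w ρ₀ hr hw)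

/-- [decided toy] Its windows are those of leaf-04's `Floored.schedule` (and of `WindowSchedule.geometric`): `ρw k = ρ₀ − (2w + r)·k`
— so `Floored.zero_mem_window` gives their inhabitation up to step `K` under `(2w + r)·K ≤ ρ₀` BY NAME (the SAME linear window
cost: the `K·w` half of LF-1 is untouched by the ratio; only the floor half is gone). [folklore] -/
theorem ρw_eq_floored (r w ρ₀ : ℝ) (hr : 0 < r) (hw : 0 < w) (k : ℕ) :
    (schedule r w ρ₀ hr hw).ρw k = (Floored.schedule r w ρ₀ hr hw).ρw k := rfl

end RatioGeometric


/-- **ON THE FLOORED WITNESS** [decided toy]: leaf-04's `Floored.schedule r w ρ₀` has floor `r∕4` (`Floored.floor_le`), so (w4) holds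
along it with the K-free profile `α := fun _ => alphaCell (w∕(r∕4)) = e³·(1 + 16w∕r)` — the binder pair (schedule, floor) of END-F‴
is inhabited with a K-free ratio (cf. the unfloored `WindowSchedule.geometric`, whose ratio `2^{k+2}w∕r` is unbounded). [folklore] -/
theorem hdom_floored {B : T4TermFormat.Booking} (r w ρ₀ : ℝ) (hr : 0 < r) (hw : 0 < w) :
    ∀ k, k + 1 ≤ B.K →
      Real.exp 3 * (1 + 4 * (2 * (Floored.schedule r w ρ₀ hr hw).σ k) / (Floored.schedule r w ρ₀ hr hw).ϱc k) ≤
        (fun _ : ℕ => alphaCell (w / (r / 4))) k :=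
  hdom_of_floor (Floored.schedule r w ρ₀ hr hw) (B := B) (by positivity) (Floored.floor_le r w ρ₀ hr hw)

/-- The floored witness's ratio constant in closed form: `w∕(r∕4) = 4w∕r`. [folklore] -/
theorem ratio_floored (r w : ℝ) : w / (r / 4) = 4 * w / r := by
  rw [div_div_eq_mul_div]; ring

end Summit.QuantumFields.BalabanUV.T4Continuum.NE1p.DressedTransportUniform

end
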